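import Summits.PneNP.PneNP.Theses.PermanentDescent
import Literature.Computability.Complexity.CircuitClassesUniformProofs
import Literature.Computability.Complexity.Counting
import Literature.Barriers.PneNP.Relativization
import Summits.PneNP.PneNP.Theorems.PermanentDescentUniformizationUnderCollapse

/-!
# Disproof of `CollapseMakesPermanentEasy` — findings (standing disprover, cycle 1, 2026-08-17)

Crux `K` = `Summit.PneNP.PneNP.Theses.PermanentDescent.CollapseMakesPermanentEasy`
(item stmt-PneNP-16142, route-PneNP-PermanentDescent, picked line `birth`):
`NP ⊆ P → PermBits ∈ P` ("no Algorithmica without Countica"; class form `P = NP ⇒ P = P^{#P}`).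

## Verdict of this cycle: NO KILL IS POSSIBLE INSIDE THE TREE, for a structural reason (§2)

* `not_crux_iff` : `¬K ↔ (NP ⊆ P ∧ PermBits ∉ P)`; `not_summit_of_not_crux` : `¬K → ¬PneNP`;
  `W_of_not_crux` : `¬K → PermanentNotInP`. A refutation of `K` is a proof of `P = NP` (the Clay
  problem decided NEGATIVELY) together with a proof of the route's OTHER crux `W`. The same holds for
  both stubs of the picked line `birth` (`not_summit_of_not_CSP`, `not_summit_of_not_U`) and for every
  statement of the shape `NP ⊆ P → X` (`not_summit_of_not_imp`) — i.e. for every typed variant in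
  STRATEGY-CENSUS.md (S1 is the one exception: refuting it proves `NP ⊆ P/poly`, `np_subset_ppoly_of_not_nonuniformShrink`).
* `crux_or_W` : `K ∨ W` is a THEOREM: the route's two cruxes cannot both be false, and
  `crux_iff_summit_or_easy` : `K ↔ (PneNP ∨ PermBits ∈ P)`.

## Load-bearing hypotheses (§3) — "any proof must use H", as far as it can be said here
* `K` has one hypothesis, the collapse `NP ⊆ P`. Dropped, `K` becomes `PermBits ∈ P`, whose negation is
  LITERALLY the sibling crux `W` (`not_cruxWithoutCollapse_iff_W`): the hypothesis is load-bearing iff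
  `W` holds — open, so no `_false_without_` theorem can be landed; the dependency is recorded as an `Iff`.
* Stub `U` (uniformization): dropping `PermBits ∈ P/poly` gives back `K` itself (`uWithoutPPoly_iff_crux`);
  dropping the collapse gives "P/poly ⇒ P for the permanent", whose negation is `PermBits ∈ P/poly ∧ W`
  (`not_uWithoutCollapse_iff`) — irrefutable short of proving polynomial-size permanent circuits.
* Stub `CSP` (the non-uniform core): dropping the collapse gives `PermBits ∈ P/poly`, whose negation is the
  STRONGER sibling `PermBits ∉ P/poly` (`not_cspWithoutCollapse_iff`).

## Joint sufficiency of the picked line (§4) — and, since 2026-08-17T12:38Z, `K ↔ CSP` outright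
`crux_iff_stubs` : `K ↔ CSP ∧ U` (re-derived from the route decls; = `Birth.crux_iff_stubs`): the cut is
exact, nothing is smuggled; each stub is NECESSARY (`not_crux_of_not_CSP`, `not_crux_of_not_U`), so a
stub-kill would again be a summit refutation. Stub `U` is now a THEOREM of the tree
(`Summit.PneNP.PneNP.Theorems.uniformizationUnderCollapse_proof`, item stmt-PneNP-16145 closed `proved`),
hence `crux_iff_CSP : K ↔ CollapseShrinksPermanent` and `not_crux_iff_not_CSP`: the crux IS its non-uniform
core, and the only open target of this disprover is `CSP : NP ⊆ P → PermBits ∈ P/poly`, whose negation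
`Collapse ∧ PermBits ∉ P/poly` (`not_CSP_iff`) is again `¬PneNP ∧ (a circuit lower bound for the permanent)`.
Under the collapse, `PermBits ∈ P ↔ PermBits ∈ P/poly` (`easy_iff_small_of_collapse`).

## Barrier side (§5; relativized / algebrized counter-worlds — the only negation work available)
* Relativization APPLIES to the class shape `O ↦ (NP^O ⊆ P^O → PP^O ⊆ P^O)`
  (`not_relativizes_classShape_of_koWorld`, modulo the cited oracle fact `KoWorld`: Ko 1989 Thm 6.4
  `P^B = NP^B ≠ PSPACE^B` via a parity set outside `PH^B`; Beigel–Maciel 1999; Aaronson–Ingram–Kretschmer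
  2022 Thm 29 `P = NP ≠ BQP = P^{#P}`). Not constructible here (no oracle-construction toolkit for
  coding oracles in the tree), hence stated as a hypothesis, not landed as a fact.
* Algebrization (route kill criterion (a), second half; STRATEGY-CENSUS "TASK for a refuter"): this seat's
  analysis (Negative-notes/affine-worlds.md, attached as evidence) — (i) in the Aydınlıoğlu–Bach affine
  model (characteristic 2 ONLY, ECCC TR16-040 §1.1.3) an affine oracle with `P = NP ∧ PP ⊄ P` is
  constructible by Ko/AIK coding + MAJORITY test regions, because every affine-extension query over
  `GF(2^k)` is a XOR of slice bits, so a `P^𝒜` machine sees an `AC⁰[⊕]` circuit of depth `O(log n)` and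
  size `2^{poly(n)}` of the test region and Razborov 1987 / Smolensky 1987 (`MAJ ∉ AC⁰[⊕]`) replaces
  Håstad — no new switching lemma is needed (the census expected one); (ii) but #P-arithmetization over
  LARGE characteristic (LFKN for the permanent over `𝔽_q`, `q > 2^n`; Aaronson–Wigderson 2008 Thm 3.4/3.5,
  `char 𝔽 ≥ 3L³`) is NOT captured by the characteristic-2 model (there `#P^𝒜` is not checkable, only `⊕SAT^𝒜`,
  AB Thm 12 / Prop 14), and in the all-fields model of AW Def. 2.2 one extension query at `(½,…,½)` over
  `𝔽_q` returns the slice count (tree: `AW56.eval_half_of_degreeOf_le_one`), so a `PP^A ⊄ P^Ã` world with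
  `NP^Ã ⊆ P^A` needs a non-slice separator (e.g. `MAJ ∘ AND₂` of two half-slices) and a lower bound against
  `AC⁰` circuits with exponentially-weighted `MOD_q` leaves for many `q` at once — beyond every known circuit
  lower bound. VERDICT: kill criterion (a) is met in the char-2 affine sense (sketch, to be refereed) and
  OPEN-and-hard in the AW all-fields sense; the engine class NOT excluded by any counter-world is exactly
  "large-characteristic #P arithmetization used to produce EXISTENCE of permanent circuits from a uniform
  collapse" — the route's named bet, now isolated precisely.

## Attacks that are void by construction (logged so nobody re-runs them)
small/finite models (`K` is an implication between asymptotic class statements; `PermBits` is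
non-degenerate: rattack `nil_zero_mem` etc.), `decide`/`native_decide` (nothing decidable), degenerate
parameters (`n = 0,1` slices are in the language definition, not hypotheses), `kit compute` (no finite
certificate bears on `NP ⊆ P`).

## Targets
None served (`stuck_stubs = []`). The machine-level stubs of `U` (`stub_laplaceWord`, `stub_soundT`,
`stub_completeT`, `stub_ansValFP`, `stub_checkFP`) are all landed theorems (Theorems/PermanentDescentCollapse…Stub*.lean),
so nothing of line `birth` remains to attack except `CSP` itself (§4b). Any future reshaping of `CSP` into stubs
should be tested here for (a) `¬T → ¬PneNP` (un-killable; `not_summit_of_not_imp`) versus (b) stubs whose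
hypotheses no longer contain the collapse (then small-model / junk-encoding attacks apply).
-/

set_option linter.dupNamespace false
set_option linter.unusedVariables false

namespace Summit.PneNP.PneNP.Cruxes.CollapseMakesPermanentEasy.Disproof

open Literature.Computability.Complexity
open Summit.PneNP.PneNP.Theses.PermanentDescent

/-! ## §0 The objects, hoisted verbatim from the route file -/

/-- The bit-graph language of the 0/1 permanent, verbatim the `let PermBits := …` of every decl of
route `PermanentDescent` (row-major `M_s(a,b) = s[b + n·a]`, bit `i` of `perm M_s` over `ℕ`). [folklore] -/
def PermBits : Language Bool :=
  {w | ∃ (n : ℕ) (s : List Bool) (i : ℕ), s.length = n * n ∧ w = Literature.Computability.Complexity.boolPair s (Computability.encodeNat i) ∧ Nat.testBit (Matrix.permanent (Matrix.of fun a b : Fin n => if s.getD ((b : ℕ) + n * (a : ℕ)) false then (1 : ℕ) else 0)) i = true}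

/-- The collapse hypothesis shared by every item of the route. [folklore] -/
def Collapse : Prop := Nondeterministic.NP ⊆ Classes.P

/-- `K` unfolded. [folklore] -/
theorem crux_iff : CollapseMakesPermanentEasy ↔ (Collapse → PermBits ∈ Classes.P) := Iff.rfl

/-- `W` (the sibling crux `PermanentNotInP`) unfolded. [folklore] -/
theorem W_iff : PermanentNotInP ↔ PermBits ∉ Classes.P := Iff.rfl

/-- Stub 1 of line `birth` = route item `CollapseShrinksPermanent` unfolded. [folklore] -/
theorem CSP_iff : CollapseShrinksPermanent ↔ (Collapse → PermBits ∈ PPoly) := Iff.rfl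

/-- Stub 2 of line `birth` = route item `UniformizationUnderCollapse` unfolded. [folklore] -/
theorem U_iff : UniformizationUnderCollapse ↔ (Collapse → PermBits ∈ PPoly → PermBits ∈ Classes.P) :=
  Iff.rfl

/-! ## §1 The hypothesis IS the negation of the summit -/

/-- `NP ⊆ P` (Cook–Karp classes) is exactly `¬PneNP`, through the proved model bridges
`P_bool_eq_holds` and `np_bool_eq` used by the route's `closes`. [folklore] -/
theorem collapse_iff_not_summit : Collapse ↔ ¬ _root_.PneNP := by
  have hP : PNPWave0.P Bool = Classes.P := Literature.Computability.Complexity.P_bool_eq_holds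
  have hN : PNPWave0.NP Bool = Nondeterministic.NP := Literature.Computability.Complexity.np_bool_eq
  unfold Collapse _root_.PneNP Literature.PNP.PNeNP
  rw [hP, hN]
  simp only [Set.subset_def, not_exists, not_and, not_not]

/-! ## §2 Irrefutability: every statement `Collapse → X` is un-killable short of `P = NP` -/

/-- Master lemma: refuting ANY implication from the collapse refutes the summit. [folklore] -/
theorem not_summit_of_not_imp {X : Prop} (h : ¬ (Collapse → X)) : ¬ _root_.PneNP :=
  fun hs => h fun hc => ((collapse_iff_not_summit.1 hc) hs).elim

/-- `¬K → ¬PneNP`: a disproof of the crux decides the Clay problem negatively. [folklore] -/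
theorem not_summit_of_not_crux (h : ¬ CollapseMakesPermanentEasy) : ¬ _root_.PneNP :=
  not_summit_of_not_imp h

/-- Same for stub 1 (`CollapseShrinksPermanent`, item stmt-PneNP-16144). [folklore] -/
theorem not_summit_of_not_CSP (h : ¬ CollapseShrinksPermanent) : ¬ _root_.PneNP :=
  not_summit_of_not_imp h

/-- Same for stub 2 (`UniformizationUnderCollapse`, item stmt-PneNP-16145). [folklore] -/
theorem not_summit_of_not_U (h : ¬ UniformizationUnderCollapse) : ¬ _root_.PneNP :=
  not_summit_of_not_imp h

/-- The summit implies the crux (vacuously). [folklore] -/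
theorem crux_of_summit (hs : _root_.PneNP) : CollapseMakesPermanentEasy :=
  fun hc => ((collapse_iff_not_summit.1 hc) hs).elim

/-- `¬K` unfolded: the world "Algorithmica without Countica". [folklore] -/
theorem not_crux_iff : ¬ CollapseMakesPermanentEasy ↔ (Collapse ∧ PermBits ∉ Classes.P) :=
  Classical.not_imp

/-- A refutation of `K` PROVES the sibling crux `W = PermanentNotInP`. [folklore] -/
theorem W_of_not_crux (h : ¬ CollapseMakesPermanentEasy) : PermanentNotInP :=
  fun hP => h fun _ => hP

/-- Hence the route's two cruxes are never both false: `K ∨ W` is a theorem. [folklore] -/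
theorem crux_or_W : CollapseMakesPermanentEasy ∨ PermanentNotInP := by
  by_cases hP : PermBits ∈ Classes.P
  · exact Or.inl fun _ => hP
  · exact Or.inr hP

/-- `K ↔ (PneNP ∨ PermBits ∈ P)`: the crux is the disjunction "the summit holds or the permanent is
easy". [folklore] -/
theorem crux_iff_summit_or_easy : CollapseMakesPermanentEasy ↔ (_root_.PneNP ∨ PermBits ∈ Classes.P) := by
  constructor
  · intro hK
    by_cases hs : _root_.PneNP
    · exact Or.inl hs
    · exact Or.inr (hK (collapse_iff_not_summit.2 hs))
  · rintro (hs | hP)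
    · exact crux_of_summit hs
    · exact fun _ => hP

/-! ## §3 Load-bearing hypotheses -/

/-- `K` with its only hypothesis (the collapse) dropped. [folklore] -/
def CruxWithoutCollapse : Prop := PermBits ∈ Classes.P

/-- Dropping the collapse from `K` leaves exactly `¬W`: so "any proof of `K` must use the collapse"
holds precisely if the sibling crux `W` is true (open; no `_false_without_` theorem is possible here).
[folklore] -/
theorem not_cruxWithoutCollapse_iff_W : ¬ CruxWithoutCollapse ↔ PermanentNotInP := Iff.rfl

/-- Stub `U` with its circuit hypothesis dropped is `K` itself. [folklore] -/
def UWithoutPPoly : Prop := Collapse → PermBits ∈ Classes.P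

/-- [folklore] -/
theorem uWithoutPPoly_iff_crux : UWithoutPPoly ↔ CollapseMakesPermanentEasy := Iff.rfl

/-- Stub `U` with the collapse dropped: "P/poly ⇒ P for the permanent". [folklore] -/
def UWithoutCollapse : Prop := PermBits ∈ PPoly → PermBits ∈ Classes.P

/-- Its negation is `PermBits ∈ P/poly ∧ W`: un-killable short of exhibiting polynomial-size
permanent circuits (believed false). In print the strongest known form is LFKN's
`PermBits ∈ P/poly ⇒ P^{#P} = MA`, not `= P`. [folklore] -/
theorem not_uWithoutCollapse_iff : ¬ UWithoutCollapse ↔ (PermBits ∈ PPoly ∧ PermanentNotInP) :=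
  Classical.not_imp

/-- Stub `CSP` with the collapse dropped: `PermBits ∈ P/poly`. [folklore] -/
def CSPWithoutCollapse : Prop := PermBits ∈ PPoly

/-- Its negation is the non-uniform strengthening of `W` (`PermBits ∉ P/poly`, which implies `W` by
`P ⊆ P/poly`). [folklore] -/
theorem W_of_not_cspWithoutCollapse (h : ¬ CSPWithoutCollapse) : PermanentNotInP :=
  fun hP => h (P_subset_PPoly_holds hP)

/-! ## §4 Joint sufficiency and necessity of the stubs of line `birth` -/

/-- The seam: `CSP → U → K` (modus ponens under the shared hypothesis). [folklore] -/
theorem crux_of_stubs (k : CollapseShrinksPermanent) (u : UniformizationUnderCollapse) :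
    CollapseMakesPermanentEasy :=
  fun h => u h (k h)

/-- The cut is exact: `K ↔ CSP ∧ U` (uses the tree theorem `P ⊆ P/poly`). [folklore] -/
theorem crux_iff_stubs : CollapseMakesPermanentEasy ↔ (CollapseShrinksPermanent ∧ UniformizationUnderCollapse) :=
  ⟨fun hK => ⟨fun h => P_subset_PPoly_holds (hK h), fun h _ => hK h⟩, fun h => crux_of_stubs h.1 h.2⟩

/-- Each stub is necessary: killing `CSP` kills `K` (hence refutes the summit, §2). [folklore] -/
theorem not_crux_of_not_CSP (h : ¬ CollapseShrinksPermanent) : ¬ CollapseMakesPermanentEasy :=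
  fun hK => h (crux_iff_stubs.1 hK).1

/-- Killing `U` kills `K`. [folklore] -/
theorem not_crux_of_not_U (h : ¬ UniformizationUnderCollapse) : ¬ CollapseMakesPermanentEasy :=
  fun hK => h (crux_iff_stubs.1 hK).2

/-- `¬U` unfolded: it needs the collapse AND small permanent circuits AND `W` at once. [folklore] -/
theorem not_U_iff :
    ¬ UniformizationUnderCollapse ↔ (Collapse ∧ PermBits ∈ PPoly ∧ PermBits ∉ Classes.P) := by
  rw [U_iff, Classical.not_imp, Classical.not_imp]

/-! ### §4b Since `U` is proved (2026-08-17T12:38Z): the crux IS its non-uniform core -/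

/-- Stub `U` is a theorem of the tree (Karp–Lipton search-to-decision with Laplace certificates,
`PermanentDescentUniformizationUnderCollapse.lean`). [folklore] -/
theorem U_holds : UniformizationUnderCollapse :=
  Summit.PneNP.PneNP.Theorems.uniformizationUnderCollapse_proof

/-- Hence `K ↔ CSP`: the crux is exactly `NP ⊆ P → PermBits ∈ P/poly`. [folklore] -/
theorem crux_iff_CSP : CollapseMakesPermanentEasy ↔ CollapseShrinksPermanent :=
  ⟨fun hK => (crux_iff_stubs.1 hK).1, fun k => crux_of_stubs k U_holds⟩

/-- … and a kill of the crux is exactly a kill of `CSP`. [folklore] -/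
theorem not_crux_iff_not_CSP : ¬ CollapseMakesPermanentEasy ↔ ¬ CollapseShrinksPermanent :=
  not_congr crux_iff_CSP

/-- `¬CSP` unfolded: the only remaining counter-world is `NP ⊆ P ∧ PermBits ∉ P/poly` — the negated summit
together with a super-polynomial CIRCUIT lower bound for the permanent. [folklore] -/
theorem not_CSP_iff : ¬ CollapseShrinksPermanent ↔ (Collapse ∧ PermBits ∉ PPoly) :=
  Classical.not_imp

/-- In Algorithmica the permanent is easy iff it is small: `NP ⊆ P → (PermBits ∈ P ↔ PermBits ∈ P/poly)`
(`U` one way, `P ⊆ P/poly` the other). [folklore] -/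
theorem easy_iff_small_of_collapse (hc : Collapse) : PermBits ∈ Classes.P ↔ PermBits ∈ PPoly :=
  ⟨fun h => P_subset_PPoly_holds h, fun h => U_holds hc h⟩

/-! ## §5 Natural strengthenings (STRATEGY-CENSUS S1/S2, D1): none is refutable here -/

/-- Census S1, the purely non-uniform form "small SAT circuits give small permanent circuits".
[folklore] -/
def NonuniformShrink : Prop := Nondeterministic.NP ⊆ PPoly → PermBits ∈ PPoly

/-- S1 implies stub `CSP` (so it is a strengthening). [folklore] -/
theorem CSP_of_nonuniformShrink (h : NonuniformShrink) : CollapseShrinksPermanent :=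
  fun hc => h (hc.trans P_subset_PPoly_holds)

/-- Refuting S1 would prove `NP ⊆ P/poly` (and `PermBits ∉ P/poly`): a kill of S1 is a disproof of
the Karp–Lipton-strengthened summit `NP ⊄ P/poly` — route kill criterion (d) decided the wrong way.
[folklore] -/
theorem np_subset_ppoly_of_not_nonuniformShrink (h : ¬ NonuniformShrink) :
    Nondeterministic.NP ⊆ PPoly ∧ PermBits ∉ PPoly :=
  Classical.not_imp.1 h

/-- Any strengthening that keeps the collapse as antecedent (census S2 `Collapse → PSPACE ⊆ P`,
D1 `Collapse → ⊕P ⊆ P`, D1' `Collapse → ⊕P ⊆ P → PermBits ∈ P`, the SFE and islands cuts) is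
un-killable short of `P = NP`, uniformly in the consequent. [folklore] -/
theorem strengthening_unkillable (X : Prop) (h : ¬ (Collapse → X)) : Collapse ∧ ¬ _root_.PneNP :=
  ⟨(Classical.not_imp.1 h).1, not_summit_of_not_imp h⟩

/-! ## §6 Barrier side: the class shape of `K` does not relativize (modulo the cited oracle) -/

/-- The class-level relativized shape of `K`: `NP^O ⊆ P^O → PP^O ⊆ P^O` (unrelativized, `PP ⊆ P`
is equivalent to `PermBits ∈ P` by Valiant 1979 + binary search; that equivalence is not in the tree
and is not needed here). [folklore] -/
def ClassShape (O : Oracle) : Prop := NPRel O ⊆ PRel O → PPRel O ⊆ PRel O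

/-- **Ko's world** (hypothesis; a printed theorem not constructed in the tree): a language oracle `B`
with `NP^B ⊆ P^B` and `PP^B ⊄ P^B`. Ko 1989 Thm 6.4 gives `P^B = NP^B ≠ PSPACE^B` with the parity set
`L_B ∉ PH^B = P^B`, and `L_B ∈ ⊕P^B ⊆ P^{PP^B}`, so `PP^B ⊄ P^B`; independently Aaronson–Ingram–Kretschmer
2022 Thm 29 (`P = NP ≠ BQP = P^{#P}`) and Beigel–Maciel 1999.
[cite: Ko1989, Thm 6.4] [cite: AaronsonIngramKretschmer2022, Thm 29] -/
def KoWorld : Prop :=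
  ∃ B : Language Bool, NPRel (Oracle.ofLanguage B) ⊆ PRel (Oracle.ofLanguage B) ∧
    ¬ PPRel (Oracle.ofLanguage B) ⊆ PRel (Oracle.ofLanguage B)

/-- Modulo Ko's world, the class shape of `K` does not relativize: every proof of `K` through its class
form must contain a non-relativizing step. [cite: Ko1989, Thm 6.4] -/
theorem not_relativizes_classShape_of_koWorld (h : KoWorld) :
    ¬ Literature.Barriers.PneNP.Relativizes ClassShape :=
  fun hrel => by
    obtain ⟨B, hNP, hPP⟩ := h
    exact hPP (hrel B hNP)

end Summit.PneNP.PneNP.Cruxes.CollapseMakesPermanentEasy.Disproof
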